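import Summits.CriticalPhenomena.PercolationContinuityZ3.Theorems.PercFiniteBoxLROCerf2015BoxLRO16Decay
import Summits.CriticalPhenomena.PercolationContinuityZ3.Theorems.PercFiniteBoxLROCerf2015BoxLRO16Connect
import HarnessLib

/-!
# `PercFiniteBoxLRO.Cerf2015BoxLRO16` (stmt-CriticalPhenomena-0860), tools VI: Cerf's §10 key estimate
# `P_p(0 ↔ x_n in Λ(n+ℓ)) ≥ θ(p)²/2` and the axis points, BOND percolation on `ℤ³`

Helper file (`--supports stmt-CriticalPhenomena-0860`), sequel of `…Decay.lean` and `…Connect.lean`: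
`P_p(edgeTwoArms i m) √m → 0` (`real_edgeTwoArms_mul_sqrt_le`, from the dyadic bound by monotonicity
in the scale), the key estimate of §10 (`exists_scale_half_theta_sq`: Lemma 10.1, Lemma 7.1 at `k = 0`,
`τ(ℓ−2) = o((ℓ−2)^{−1/2})`, valid as soon as `4(ℓ−2) ≥ n^16`), even axis points `2σ m e_j` inside
`Λ(n^16 − 3n)` for `N₁ ≤ m ≤ n` (`exists_axis_even`, with `ℓ = n^16 − 3n − 3m`), and all axis points
(`exists_axis_all`: odd ones by one more open edge, short ones by a straight segment).
This file introduces no definition.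

## References

* R. Cerf, *A lower bound on the two-arms exponent for critical percolation on the lattice*, Ann.
  Probab. 43 (2015) 2458–2480, arXiv:1306.3105 [Cerf2015].
-/

noncomputable section

namespace Summit.CriticalPhenomena.PercolationContinuityZ3.Theorems

namespace Cerf2015BoxLRO16

open Literature.Probability.Percolation Literature.Probability.Percolation.AKN
  Literature.Probability.Percolation.GM Literature.Probability.LatticeModels MeasureTheory Finset Real
open scoped Classical

variable {d : ℕ}

/-- **The two-arms probability of an edge is `o(m^{−1/2})` at `θ(p) > 0`** (Cerf 2015, Theorem 1.1 run
at a parameter with `θ(p) > 0` as in §10, bond version on `ℤ³`, in the qualitative form the proof of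
Theorem 1.3 consumes): for `0 < p < 1` with `θ(p) > 0` and every `ε > 0` there is `m₀` such that
`P_p(edgeTwoArms i m) √m ≤ ε` for all `m ≥ m₀` and all directions `i` (indeed `≤ c m^{−1/112}`).
[cite: Cerf2015, Thm 1.1 and §10] -/
theorem real_edgeTwoArms_mul_sqrt_le (p : unitInterval) (hp0 : 0 < (p : ℝ)) (hp1 : (p : ℝ) < 1)
    (hθ : 0 < theta (zdGraph 3) 0 p) {ε : ℝ} (hε : 0 < ε) :
    ∃ m₀ : ℕ, 1 ≤ m₀ ∧ ∀ m : ℕ, m₀ ≤ m → ∀ i : Fin 3,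
      (bondPercolation (zdGraph 3) p).real (edgeTwoArms i m) * Real.sqrt m ≤ ε := by
  obtain ⟨C, hC⟩ := real_edgeTwoArms_dyadic_le p hp0 hp1 hθ
  -- `C ≥ 0` (instance `s = 1`)
  have hC0 : 0 ≤ C := by
    have h := hC 1 _ le_rfl rfl 0
    exact le_trans (by positivity) h
  obtain ⟨D, hD⟩ : ∃ D : ℝ, D = C * (Real.sqrt 3 * Real.sqrt ((2 : ℝ) ^ 57)) := ⟨_, rfl⟩
  have hD0 : 0 ≤ D := by rw [hD]; positivity
  have hsqrt2 : 1 < Real.sqrt 2 := by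
    rw [show (1 : ℝ) = Real.sqrt 1 from Real.sqrt_one.symm]
    exact Real.sqrt_lt_sqrt zero_le_one one_lt_two
  obtain ⟨s₁, hs₁⟩ := pow_unbounded_of_one_lt (D / ε) hsqrt2
  set s₀ := max s₁ 1 with hs₀
  have hs₀1 : 1 ≤ s₀ := le_max_right _ _
  have hpow : D / ε < Real.sqrt 2 ^ s₀ :=
    hs₁.trans_le (pow_le_pow_right₀ hsqrt2.le (le_max_left _ _))
  refine ⟨3 * ((2 * 2 ^ s₀ + 1) * 2 ^ (55 * s₀) + 2 ^ s₀), Nat.one_le_iff_ne_zero.mpr (by positivity), ?_⟩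
  intro m hm i
  obtain ⟨s, hs, h1, h2⟩ := exists_window hm
  set ns := (2 * 2 ^ s + 1) * 2 ^ (55 * s) + 2 ^ s with hns
  set ns' := (2 * 2 ^ (s + 1) + 1) * 2 ^ (55 * (s + 1)) + 2 ^ (s + 1) with hns'
  have hs1 : 1 ≤ s := hs₀1.trans hs
  have hkey := hC s ns hs1 rfl i
  have hns1 : 1 ≤ ns := Nat.one_le_iff_ne_zero.mpr (by positivity)
  have hanti := real_edgeTwoArms_anti p i (m := 3 * ns) (m' := m) (by omega) h1
  have hgrow : (ns' : ℝ) ≤ 2 ^ 57 * ns := by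
    have := nseq_succ_le s
    exact_mod_cast this
  have hm' : (m : ℝ) ≤ 3 * (2 ^ 57 * ns) := by
    have : (m : ℝ) ≤ 3 * ns' := by exact_mod_cast h2
    linarith
  have hsqm : Real.sqrt m ≤ Real.sqrt 3 * Real.sqrt ((2 : ℝ) ^ 57) * Real.sqrt ns := by
    rw [← Real.sqrt_mul (by norm_num), ← Real.sqrt_mul (by positivity)]
    exact Real.sqrt_le_sqrt (by linarith)
  have hpos2 : 0 < Real.sqrt 2 ^ s := by positivity
  have hss₀ : Real.sqrt 2 ^ s₀ ≤ Real.sqrt 2 ^ s := pow_le_pow_right₀ hsqrt2.le hs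
  calc (bondPercolation (zdGraph 3) p).real (edgeTwoArms i m) * Real.sqrt m
      ≤ (bondPercolation (zdGraph 3) p).real (edgeTwoArms i (3 * ns)) * (Real.sqrt 3 * Real.sqrt ((2 : ℝ) ^ 57) * Real.sqrt ns) :=
        mul_le_mul hanti hsqm (Real.sqrt_nonneg _) measureReal_nonneg
    _ = ((bondPercolation (zdGraph 3) p).real (edgeTwoArms i (3 * ns)) * Real.sqrt ns * Real.sqrt 2 ^ s) *
          (Real.sqrt 3 * Real.sqrt ((2 : ℝ) ^ 57)) / Real.sqrt 2 ^ s := by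
        field_simp
    _ ≤ C * (Real.sqrt 3 * Real.sqrt ((2 : ℝ) ^ 57)) / Real.sqrt 2 ^ s := by
        gcongr
    _ = D / Real.sqrt 2 ^ s := by rw [hD]
    _ ≤ D / Real.sqrt 2 ^ s₀ := div_le_div_of_nonneg_left hD0 (by positivity) hss₀
    _ ≤ ε := by
        rw [div_le_iff₀ (by positivity)]
        have := (div_lt_iff₀ hε).1 hpow
        linarith

/-- **Cerf 2015, §10, the key estimate, bond version on `ℤ³`**: for `0 < p < 1` with `θ(p) > 0` there
is `m₀` such that for all `n ≥ 1`, all `ℓ ≥ 3` with `ℓ − 2 ≥ m₀` and `n^16 ≤ 4(ℓ − 2)`, and the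
boundary point `b` of `exists_boundary_point_theta`,
`P_p(0 ↔ b in Λ(n+ℓ)) ≥ θ(p)²/2` ("By theorem 1.1, for `n` large enough, `P(0 ↔ x_n in Λ(n+n^α))
≥ θ(p)²/2`": Lemma 10.1, Lemma 7.1 with `k = 0` — cost `|Λ(n+1)| |E(Λ(n+1))|/p ≍ n^6` — the factor
`|∂ⁱⁿΛ(n)|/θ ≍ n²`, and `τ(ℓ−2) = o((ℓ−2)^{−1/2}) = o(n^{−8})`). [cite: Cerf2015, §10] -/
theorem exists_scale_half_theta_sq (p : unitInterval) (hp0 : 0 < (p : ℝ)) (hp1 : (p : ℝ) < 1)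
    (hθ : 0 < theta (zdGraph 3) 0 p) :
    ∃ m₀ : ℕ, 1 ≤ m₀ ∧ ∀ n ℓ : ℕ, 1 ≤ n → 3 ≤ ℓ → m₀ ≤ ℓ - 2 → n ^ 16 ≤ 4 * (ℓ - 2) →
      ∀ b ∈ box 3 n, theta (zdGraph 3) 0 p / (6 * (2 * (n : ℝ) + 1) ^ 2) ≤
          (bondPercolation (zdGraph 3) p).real (bconn (box 3 n) 0 b) →
        theta (zdGraph 3) 0 p ^ 2 / 2 ≤ (bondPercolation (zdGraph 3) p).real (bconn (box 3 (n + ℓ)) 0 b) := by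
  obtain ⟨θ, hθdef⟩ : ∃ θ' : ℝ, θ' = theta (zdGraph 3) 0 p := ⟨_, rfl⟩
  rw [← hθdef] at hθ ⊢
  obtain ⟨K₀, hK₀⟩ : ∃ K₀ : ℝ, K₀ = 751 * 125 * 54 := ⟨_, rfl⟩
  have hK₀0 : 0 < K₀ := by rw [hK₀]; norm_num
  have hε : 0 < (p : ℝ) * θ ^ 3 / (12 * K₀) := by positivity
  obtain ⟨m₀, hm₀1, hm₀⟩ := real_edgeTwoArms_mul_sqrt_le p hp0 hp1 (hθdef ▸ hθ) hε
  refine ⟨m₀, hm₀1, ?_⟩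
  intro n ℓ hn hℓ hmℓ h16 b hb hqb
  set μ := bondPercolation (zdGraph 3) p with hμ
  have hn0 : (0 : ℝ) < n := by exact_mod_cast hn
  have hn1 : (1 : ℝ) ≤ n := by exact_mod_cast hn
  -- Lemma 10.1
  have hbN : b ∈ box 3 (n + ℓ) := box_mono 3 (Nat.le_add_right n ℓ) hb
  have h101 := theta_sq_le_real_bconn_add (d := 3) p (zero_mem_box 3 (n + ℓ)) hbN (n := n) (ℓ := ℓ)
  rw [← hθdef] at h101
  -- Lemma 7.1 with `k = 0`
  have h71 := real_twoArmsBox_mul_le (d := 3) p hp0 (n := n) (k := 0) (ℓ := ℓ) (by omega) (zero_mem_box 3 n) hb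
  simp only [Nat.add_zero, Nat.sub_zero] at h71
  -- the quantities
  obtain ⟨T, hT⟩ : ∃ T : ℝ, T = ∑ i : Fin 3, μ.real (edgeTwoArms i (ℓ - 2)) := ⟨_, rfl⟩
  have hT0 : 0 ≤ T := by rw [hT]; exact Finset.sum_nonneg fun _ _ => measureReal_nonneg
  obtain ⟨q₀, hq₀⟩ : ∃ q₀ : ℝ, q₀ = θ / (6 * (2 * (n : ℝ) + 1) ^ 2) := ⟨_, rfl⟩
  have hq₀0 : 0 < q₀ := by rw [hq₀]; positivity
  rw [← hq₀] at hqb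
  obtain ⟨R, hR⟩ : ∃ R : ℝ, R = (1 + ((edgesIn (zdGraph 3) (box 3 (n + 1))).card : ℝ) / p) * ((box 3 (n + 1)).card : ℝ) := ⟨_, rfl⟩
  have hR0 : 0 ≤ R := by rw [hR]; positivity
  have h71' : μ.real (twoArmsBox n ℓ 0 b) * μ.real (bconn (box 3 n) 0 b) ≤ R * T := by
    rw [hR, hT, mul_assoc]; exact h71
  -- `P(twoArmsBox) ≤ R T / q₀`
  have htwo : μ.real (twoArmsBox n ℓ 0 b) ≤ R * T / q₀ := by
    rw [le_div_iff₀ hq₀0]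
    calc μ.real (twoArmsBox n ℓ 0 b) * q₀ ≤ μ.real (twoArmsBox n ℓ 0 b) * μ.real (bconn (box 3 n) 0 b) :=
          mul_le_mul_of_nonneg_left hqb measureReal_nonneg
      _ ≤ R * T := h71'
  -- `R ≤ 751 · 125 n^6 / p` and `1/q₀ = 6(2n+1)²/θ ≤ 54 n²/θ`
  have hRle : R ≤ 751 * 125 * (n : ℝ) ^ 6 / p := by
    have hE := card_edgesIn_box_three_le (n + 1)
    rw [hR, card_box]
    push_cast at hE ⊢
    have h5 : (2 * ((n : ℝ) + 1) + 1) ≤ 5 * n := by linarith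
    have h53 : (2 * ((n : ℝ) + 1) + 1) ^ 3 ≤ (5 * (n : ℝ)) ^ 3 := pow_le_pow_left₀ (by linarith) h5 3
    have hn3 : (1 : ℝ) ≤ (5 * (n : ℝ)) ^ 3 := one_le_pow₀ (by linarith)
    have hp1' : (p : ℝ) ≤ 1 := p.2.2
    have h1 : 1 + ((edgesIn (zdGraph 3) (box 3 (n + 1))).card : ℝ) / p ≤ 751 * (n : ℝ) ^ 3 / p := by
      rw [add_div' _ _ _ hp0.ne', div_le_div_iff_of_pos_right hp0]
      nlinarith
    calc (1 + ((edgesIn (zdGraph 3) (box 3 (n + 1))).card : ℝ) / p) * (2 * ((n : ℝ) + 1) + 1) ^ 3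
        ≤ (751 * (n : ℝ) ^ 3 / p) * (5 * (n : ℝ)) ^ 3 :=
          mul_le_mul h1 h53 (by positivity) (div_nonneg (by positivity) hp0.le)
      _ = 751 * 125 * (n : ℝ) ^ 6 / p := by ring
  have hq₀inv : 1 / q₀ ≤ 54 * (n : ℝ) ^ 2 / θ := by
    rw [hq₀, one_div_div, div_le_div_iff_of_pos_right hθ]
    nlinarith
  -- `T ≤ 3 ε / √(ℓ-2)` and `√(ℓ-2) ≥ n^8 / 2`
  have hm1 : 1 ≤ ℓ - 2 := hm₀1.trans hmℓ
  have hsq0 : 0 < Real.sqrt ((ℓ - 2 : ℕ) : ℝ) := Real.sqrt_pos.2 (by exact_mod_cast hm1)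
  have hTle : T * Real.sqrt ((ℓ - 2 : ℕ) : ℝ) ≤ 3 * ((p : ℝ) * θ ^ 3 / (12 * K₀)) := by
    rw [hT, Finset.sum_mul]
    calc ∑ i : Fin 3, μ.real (edgeTwoArms i (ℓ - 2)) * Real.sqrt ((ℓ - 2 : ℕ) : ℝ)
        ≤ ∑ _i : Fin 3, (p : ℝ) * θ ^ 3 / (12 * K₀) := Finset.sum_le_sum fun i _ => hm₀ (ℓ - 2) hmℓ i
      _ = 3 * ((p : ℝ) * θ ^ 3 / (12 * K₀)) := by
          rw [Finset.sum_const, Finset.card_univ, Fintype.card_fin, nsmul_eq_mul]; push_cast; ring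
  have hsqrt : (n : ℝ) ^ 8 ≤ 2 * Real.sqrt ((ℓ - 2 : ℕ) : ℝ) := by
    have h4 : ((n : ℝ) ^ 8) ^ 2 ≤ (2 * Real.sqrt ((ℓ - 2 : ℕ) : ℝ)) ^ 2 := by
      have h16r : ((n ^ 16 : ℕ) : ℝ) ≤ ((4 * (ℓ - 2) : ℕ) : ℝ) := by exact_mod_cast h16
      push_cast at h16r
      calc ((n : ℝ) ^ 8) ^ 2 = (n : ℝ) ^ 16 := by ring
        _ ≤ 4 * ((ℓ - 2 : ℕ) : ℝ) := h16r
        _ = (2 * Real.sqrt ((ℓ - 2 : ℕ) : ℝ)) ^ 2 := by rw [mul_pow, Real.sq_sqrt (Nat.cast_nonneg _)]; norm_num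
    exact (pow_le_pow_iff_left₀ (by positivity) (by positivity) two_ne_zero).1 h4
  -- combine: `P(twoArmsBox) ≤ θ²/2`
  have hfinal : μ.real (twoArmsBox n ℓ 0 b) ≤ θ ^ 2 / 2 := by
    have hn8 : (0 : ℝ) < (n : ℝ) ^ 8 := by positivity
    have step1 : R * T / q₀ ≤ (751 * 125 * (n : ℝ) ^ 6 / p) * T * (54 * (n : ℝ) ^ 2 / θ) := by
      rw [div_eq_mul_one_div]
      exact mul_le_mul (mul_le_mul_of_nonneg_right hRle hT0) hq₀inv (by positivity) (by positivity)
    have step2 : (751 * 125 * (n : ℝ) ^ 6 / p) * T * (54 * (n : ℝ) ^ 2 / θ) = K₀ / ((p : ℝ) * θ) * ((n : ℝ) ^ 8 * T) := by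
      rw [hK₀]; field_simp
    have step3 : (n : ℝ) ^ 8 * T ≤ 2 * (3 * ((p : ℝ) * θ ^ 3 / (12 * K₀))) := by
      calc (n : ℝ) ^ 8 * T ≤ (2 * Real.sqrt ((ℓ - 2 : ℕ) : ℝ)) * T := mul_le_mul_of_nonneg_right hsqrt hT0
        _ = 2 * (T * Real.sqrt ((ℓ - 2 : ℕ) : ℝ)) := by ring
        _ ≤ 2 * (3 * ((p : ℝ) * θ ^ 3 / (12 * K₀))) := by linarith
    calc μ.real (twoArmsBox n ℓ 0 b) ≤ R * T / q₀ := htwo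
      _ ≤ K₀ / ((p : ℝ) * θ) * ((n : ℝ) ^ 8 * T) := by rw [← step2]; exact step1
      _ ≤ K₀ / ((p : ℝ) * θ) * (2 * (3 * ((p : ℝ) * θ ^ 3 / (12 * K₀)))) := mul_le_mul_of_nonneg_left step3 (by positivity)
      _ = θ ^ 2 / 2 := by field_simp; ring
  linarith

/-- **Cerf 2015, §10: "for all `n ≥ N`, for all `k ∈ {N, …, n}`, `P(0 ↔ 2k e₁ in Λ(4n+n^α)) ≥ θ(p)⁴/4`"**,
bond version on `ℤ³` (box `Λ(n^16 − 3n)`): for `0 < p < 1` with `θ(p) > 0` there is `N₁ ≥ 2` such that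
for `N₁ ≤ m ≤ n`, every axis `j` and sign `σ`, `P_p(0 ↔ 2σ m e_j in Λ(n^16 − 3n)) ≥ (θ(p)²/2)²`.
[cite: Cerf2015, §10] -/
theorem exists_axis_even (p : unitInterval) (hp0 : 0 < (p : ℝ)) (hp1 : (p : ℝ) < 1)
    (hθ : 0 < theta (zdGraph 3) 0 p) :
    ∃ N₁ : ℕ, 2 ≤ N₁ ∧ ∀ n m : ℕ, N₁ ≤ n → N₁ ≤ m → m ≤ n → ∀ (j : Fin 3) (s : ℤˣ),
      (theta (zdGraph 3) 0 p ^ 2 / 2) ^ 2 ≤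
        (bondPercolation (zdGraph 3) p).real (bconn (box 3 (n ^ 16 - 3 * n)) 0 (Pi.single j ((s : ℤ) * (2 * m)))) := by
  obtain ⟨m₀, _, hkey⟩ := exists_scale_half_theta_sq p hp0 hp1 hθ
  refine ⟨max 2 m₀, le_max_left _ _, ?_⟩
  intro n m hn hm hmn j s
  have hn2 : 2 ≤ n := (le_max_left _ _).trans hn
  have hm1 : 1 ≤ m := by have := (le_max_left 2 m₀).trans hm; omega
  have h16 := pow_sixteen_ge hn2
  have hm16 : m ^ 16 ≤ n ^ 16 := Nat.pow_le_pow_left hmn 16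
  have hm₀n : m₀ ≤ n := (le_max_right _ _).trans hn
  obtain ⟨b, hb, hqb⟩ := exists_boundary_point_theta p hm1
  have hbbox : b ∈ box 3 m := (mem_innerBoundary_iff.1 hb).1
  obtain ⟨ℓ, hℓ⟩ : ∃ ℓ : ℕ, ℓ = n ^ 16 - 3 * n - 3 * m := ⟨_, rfl⟩
  have hℓ3 : 3 ≤ ℓ := by omega
  have hℓm₀ : m₀ ≤ ℓ - 2 := by omega
  have hℓ16 : m ^ 16 ≤ 4 * (ℓ - 2) := by omega
  have hη := hkey m ℓ hm1 hℓ3 hℓm₀ hℓ16 b hbbox hqb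
  have hax := sq_le_real_bconn_axis (d := 3) p hb (by positivity) hη j s
  have hR : m + ℓ + 2 * m = n ^ 16 - 3 * n := by omega
  rw [hR] at hax
  exact hax

/-- **All axis points** (Cerf 2015, §10: "`P(0 ↔ k e₁ in Λ(4n+n^α)) ≥ (p/4) θ(p)⁴` for `2N ≤ k ≤ 2n`"
and "this lower bound can be extended to every `n ≥ 1` by taking a smaller value of `ρ`"), bond
version on `ℤ³`: there are `N₁ ≥ 2` and `ρ₁ > 0` with `P_p(0 ↔ σ k e_j in Λ(n^16 − 3n)) ≥ ρ₁` for all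
`n ≥ N₁`, `k ≤ 2n+1`, axes `j`, signs `σ` (even `k ≥ 2N₁` from `exists_axis_even`, odd by one more edge,
small `k` by a straight segment). [cite: Cerf2015, §10] -/
theorem exists_axis_all (p : unitInterval) (hp0 : 0 < (p : ℝ)) (hp1 : (p : ℝ) < 1)
    (hθ : 0 < theta (zdGraph 3) 0 p) :
    ∃ N₁ : ℕ, 2 ≤ N₁ ∧ ∃ ρ₁ : ℝ, 0 < ρ₁ ∧ ∀ n : ℕ, N₁ ≤ n → ∀ (j : Fin 3) (s : ℤˣ) (k : ℕ), k ≤ 2 * n + 1 →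
      ρ₁ ≤ (bondPercolation (zdGraph 3) p).real (bconn (box 3 (n ^ 16 - 3 * n)) 0 (Pi.single j ((s : ℤ) * k))) := by
  obtain ⟨N₁, hN₁2, hA⟩ := exists_axis_even p hp0 hp1 hθ
  obtain ⟨η2, hη2⟩ : ∃ η2 : ℝ, η2 = (theta (zdGraph 3) 0 p ^ 2 / 2) ^ 2 := ⟨_, rfl⟩
  have hη20 : 0 < η2 := by rw [hη2]; positivity
  refine ⟨N₁, hN₁2, min ((p : ℝ) * η2) ((p : ℝ) ^ (2 * N₁)), lt_min (by positivity) (by positivity), ?_⟩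
  intro n hn j s k hk
  set μ := bondPercolation (zdGraph 3) p with hμ
  have hn2 : 2 ≤ n := hN₁2.trans hn
  have h16 := pow_sixteen_ge hn2
  by_cases hsmall : k < 2 * N₁
  · have hkB : k ≤ n ^ 16 - 3 * n := by omega
    calc min ((p : ℝ) * η2) ((p : ℝ) ^ (2 * N₁)) ≤ (p : ℝ) ^ (2 * N₁) := min_le_right _ _
      _ ≤ (p : ℝ) ^ k := pow_le_pow_of_le_one p.2.1 p.2.2 hsmall.le
      _ ≤ _ := pow_le_real_bconn_single p j s hkB
  · push Not at hsmall
    obtain ⟨m, hm⟩ := Nat.even_or_odd' k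
    have hmN : N₁ ≤ m := by omega
    have hmn : m ≤ n := by omega
    have hAm := hA n m hn hmN hmn j s
    rw [← hη2] at hAm
    have hpη : min ((p : ℝ) * η2) ((p : ℝ) ^ (2 * N₁)) ≤ (p : ℝ) * η2 := min_le_left _ _
    rcases hm with hm | hm
    · -- even
      have hk2 : (s : ℤ) * (k : ℤ) = (s : ℤ) * (2 * (m : ℤ)) := by rw [hm]; push_cast; ring
      rw [hk2]
      calc min ((p : ℝ) * η2) ((p : ℝ) ^ (2 * N₁)) ≤ (p : ℝ) * η2 := hpη
        _ ≤ 1 * η2 := mul_le_mul_of_nonneg_right p.2.2 hη20.le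
        _ = η2 := one_mul _
        _ ≤ _ := hAm
    · -- odd: one more edge
      have hv : (Pi.single j ((s : ℤ) * (2 * m)) : Site 3) ∈ box 3 (n ^ 16 - 3 * n) := by
        rw [mem_box]; intro l
        have hB : 2 * (m : ℤ) ≤ ((n ^ 16 - 3 * n : ℕ) : ℤ) := by
          have : 2 * m ≤ n ^ 16 - 3 * n := by omega
          exact_mod_cast this
        by_cases hlj : l = j
        · subst hlj; rw [Pi.single_eq_same]
          rcases Int.units_eq_one_or s with hs | hs <;> simp [hs] <;> omega
        · rw [Pi.single_eq_of_ne hlj]; simp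
      have hw : (Pi.single j ((s : ℤ) * k) : Site 3) ∈ box 3 (n ^ 16 - 3 * n) := by
        rw [mem_box]; intro l
        have hB : (k : ℤ) ≤ ((n ^ 16 - 3 * n : ℕ) : ℤ) := by
          have : k ≤ n ^ 16 - 3 * n := by omega
          exact_mod_cast this
        by_cases hlj : l = j
        · subst hlj; rw [Pi.single_eq_same]
          rcases Int.units_eq_one_or s with hs | hs <;> simp [hs] <;> omega
        · rw [Pi.single_eq_of_ne hlj]; simp
      have hadj : (zdGraph 3).Adj (Pi.single j ((s : ℤ) * (2 * m))) (Pi.single j ((s : ℤ) * k)) := by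
        rw [zdGraph_adj_iff]
        refine ⟨j, ?_⟩
        rcases Int.units_eq_one_or s with hs | hs
        · left
          have e : (1 : ℤ) * ((2 * m + 1 : ℕ) : ℤ) = 1 * (2 * (m : ℤ)) + 1 := by push_cast; ring
          rw [hs, Units.val_one, hm, e, Pi.single_add]
        · right
          have e : (-1 : ℤ) * (2 * (m : ℤ)) = -1 * ((2 * m + 1 : ℕ) : ℤ) + 1 := by push_cast; ring
          rw [hs, Units.val_neg, Units.val_one, hm, e, Pi.single_add]
      have h := real_bconn_adj_le p hadj hv hw (x := 0)
      calc min ((p : ℝ) * η2) ((p : ℝ) ^ (2 * N₁)) ≤ (p : ℝ) * η2 := hpη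
        _ ≤ (p : ℝ) * μ.real (bconn (box 3 (n ^ 16 - 3 * n)) 0 (Pi.single j ((s : ℤ) * (2 * m)))) :=
            mul_le_mul_of_nonneg_left hAm p.2.1
        _ ≤ _ := h

end Cerf2015BoxLRO16

end Summit.CriticalPhenomena.PercolationContinuityZ3.Theorems

end
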